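import Mathlib
import Literature.Computability.Complexity.DecisionTreeQueries
import HarnessLib

/-!
# Crux `PseudoBoundedAA` (stmt-QuantumAdvantage-15237, route SosSandwich) — the `L²`-OSSS question on the classical
# corner: NO-GO for the per-tree (variance-normalised bilinear) route, part 1/2 — the caterpillar tree and the
# terminal-run length

Support file (`--supports stmt-QuantumAdvantage-15237`); the no-go theorem itself is in part 2
(`…ClassicalCornerL2OSSSNoGo.lean`), whose header explains the context (the census's `L²`-OSSS law
`16·Var[p]² ≤ C₀·Σⱼ δ̄ⱼ·Infⱼ[p]` on the classical corner `R_T`, known with `C₀ = Ī` via the per-tree bilinear OSSS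
inequality `osss_sens`; the question whether `I[F]` can be replaced there by a multiple of `Var[F]`).

This part supplies the two explicit objects and their bookkeeping, in the un-normalised cube sums of `osss_sens`:

* `sum_ite_forall_mem` — subcube sums `Σₓ [∀ i ∈ C, x i = 1] = 2^{N−|C|}` (halving along a free coordinate);
* `pathTree_list`, **`exists_caterpillar`** — the CATERPILLAR (path) tree `t_N` on `N` bits: read `x₀, x₁, …` in
  order, reject at the first `0`, accept `1^N`; `eval = AND_N`, `depth = N`, and `j ∈ t_N.queries x → x₀ = … = x_{j−1} = 1`,
  whence `card_queries_caterpillar_le`: `#{x : j ∈ t_N.queries x} ≤ 2^{N−j}` (`δⱼ ≤ 2^{−j}`); `sum_ite_forall_eq_one`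
  (`Σ F = 1` for `F = AND_N`);
* the TERMINAL-RUN LENGTH `g(x) = #{m : x_m = … = x_{N−1} = 1} = Σ_m [∀ i ≥ m, x i = 1]` (taken as a hypothesis `hg`
  on a real function `g`, no definition is introduced): `increment_runLength`
  (`g(x^{j→1}) − g(x^{j→0}) = Σ_{m ≤ j} [∀ i ≥ m, i ≠ j → x i = 1]`, nested indicators), `runInd_mul_runInd`,
  `sum_runInd_mul_runInd` (`Σₓ` of a product of two of them `= 2^{min(m,m')+1}`), `sum_sum_pow_min_le`
  (`Σ_{m,m' ≤ j} 2^{min(m,m')} + 2j + 5 ≤ 6·2^j`), and **`sum_sq_increment_runLength_le`**: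
  `Σₓ (g(x^{j→1}) − g(x^{j→0}))² ≤ 12·2^j`, i.e. `Infⱼ[g] ≤ 12·2^{j−N}` — the function is sensitive exactly where the
  caterpillar rarely looks.

Honest label: calibration inside the classical corner of an open conjecture; no registered stub, crux or summit is
closed.  Sources: R. O'Donnell, M. Saks, O. Schramm, R. Servedio, *Every decision tree has an influential variable*,
FOCS 2005, Thm 3.2; R. O'Donnell, *Analysis of Boolean Functions* (2014) §8.6.
-/

set_option linter.dupNamespace false

noncomputable section

namespace Summit.QuantumAdvantage.QuantumAdvantage.Theorems.SosSandwich

open Finset Function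
open Literature.Computability.Complexity

namespace ClassicalCornerL2OSSSNoGo

variable {N : ℕ}

/-! ### Subcube sums -/

/-- Half-cube sum: if `ψ` does not depend on `x a`, then `Σₓ [x a = 1]·ψ(x) = ½ Σₓ ψ(x)`. [folklore] -/
theorem sum_ite_apply_eq_half (a : Fin N) (ψ : (Fin N → Bool) → ℝ) (hψ : ∀ x c, ψ (update x a c) = ψ x) :
    ∑ x, (if x a = true then ψ x else 0) = (∑ x, ψ x) / 2 := by
  let τ : (Fin N → Bool) → (Fin N → Bool) := fun x => update x a (!x a)
  have hτ : Function.Involutive τ := by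
    intro x
    simp only [τ, update_self, update_idem, Bool.not_not, update_eq_self]
  have key : ∑ x, (if x a = true then ψ x else 0) = ∑ x, (if x a = true then 0 else ψ x) := by
    rw [← Equiv.sum_comp (hτ.toPerm τ) (fun x => if x a = true then 0 else ψ x)]
    refine Finset.sum_congr rfl fun x _ => ?_
    simp only [Function.Involutive.coe_toPerm]
    rcases Bool.eq_false_or_eq_true (x a) with hx | hx
    · simp [τ, hx, hψ]
    · simp [τ, hx]
  have hsum : (∑ x, (if x a = true then ψ x else 0)) + ∑ x, (if x a = true then 0 else ψ x) = ∑ x, ψ x := by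
    rw [← Finset.sum_add_distrib]
    exact Finset.sum_congr rfl fun x _ => by split_ifs <;> ring
  rw [← key] at hsum
  linarith

/-- **Subcube sums.** `Σₓ [∀ i ∈ C, x i = 1] = 2^N / 2^{|C|}`. [folklore] -/
theorem sum_ite_forall_mem_div (C : Finset (Fin N)) :
    ∑ x : Fin N → Bool, (if ∀ i ∈ C, x i = true then (1 : ℝ) else 0) = (2 : ℝ) ^ N / (2 : ℝ) ^ C.card := by
  classical
  induction C using Finset.induction_on with
  | empty =>
    simp only [Finset.notMem_empty, IsEmpty.forall_iff, implies_true, ↓reduceIte, sum_const, card_univ,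
      Fintype.card_fun, Fintype.card_bool, Fintype.card_fin, nsmul_eq_mul, mul_one, card_empty, pow_zero, div_one]
    push_cast
    ring
  | insert a C ha ih =>
    have hre : ∀ x : Fin N → Bool, (if ∀ i ∈ insert a C, x i = true then (1 : ℝ) else 0)
        = if x a = true then (if ∀ i ∈ C, x i = true then (1 : ℝ) else 0) else 0 := by
      intro x
      by_cases hxa : x a = true
      · by_cases hC : ∀ i ∈ C, x i = true
        · rw [if_pos hxa, if_pos hC, if_pos]
          intro i hi
          rcases Finset.mem_insert.mp hi with rfl | hi
          · exact hxa
          · exact hC i hi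
        · rw [if_pos hxa, if_neg hC, if_neg]
          exact fun h => hC fun i hi => h i (Finset.mem_insert_of_mem hi)
      · rw [if_neg hxa, if_neg]
        exact fun h => hxa (h a (Finset.mem_insert_self a C))
    rw [Finset.sum_congr rfl fun x _ => hre x]
    have hinv : ∀ (x : Fin N → Bool) (c : Bool),
        (if ∀ i ∈ C, (update x a c) i = true then (1 : ℝ) else 0) = if ∀ i ∈ C, x i = true then (1 : ℝ) else 0 := by
      intro x c
      have hiff : (∀ i ∈ C, (update x a c) i = true) ↔ ∀ i ∈ C, x i = true := by
        refine forall₂_congr fun i hi => ?_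
        rw [update_of_ne (ne_of_mem_of_not_mem hi ha)]
      simp only [hiff]
    rw [sum_ite_apply_eq_half a _ hinv, ih, Finset.card_insert_of_notMem ha, pow_succ]
    ring

/-- **Subcube sums, exponent form.** `Σₓ [∀ i ∈ C, x i = 1] = 2^{N − |C|}`. [folklore] -/
theorem sum_ite_forall_mem (C : Finset (Fin N)) :
    ∑ x : Fin N → Bool, (if ∀ i ∈ C, x i = true then (1 : ℝ) else 0) = (2 : ℝ) ^ (N - C.card) := by
  have hle : C.card ≤ N := by
    calc C.card ≤ (Finset.univ : Finset (Fin N)).card := Finset.card_le_card (Finset.subset_univ C)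
      _ = N := by rw [Finset.card_univ, Fintype.card_fin]
  rw [sum_ite_forall_mem_div, div_eq_iff (by positivity), ← pow_add, Nat.sub_add_cancel hle]

/-! ### The caterpillar (path) tree -/

/-- The path tree along a strictly increasing list of coordinates: read them in order, reject at the first `0`,
accept if all are `1`; its queries on `x` are an initial segment ending at the first `0`. [folklore] -/
theorem pathTree_list (l : List (Fin N)) (hl : l.Pairwise (· < ·)) :
    (∀ x, (l.foldr (fun i acc => DecisionTree.query i (DecisionTree.leaf false) acc)
        (DecisionTree.leaf true)).eval x = true ↔ ∀ i ∈ l, x i = true) ∧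
    (∀ x j, j ∈ (l.foldr (fun i acc => DecisionTree.query i (DecisionTree.leaf false) acc)
        (DecisionTree.leaf true)).queries x → j ∈ l ∧ ∀ i ∈ l, i < j → x i = true) ∧
    (l.foldr (fun i acc => DecisionTree.query i (DecisionTree.leaf false) acc)
        (DecisionTree.leaf true)).depth = l.length := by
  induction l with
  | nil =>
    refine ⟨fun x => ?_, fun x j hj => ?_, ?_⟩
    · simp
    · simp at hj
    · simp
  | cons a l ih =>
    rw [List.pairwise_cons] at hl
    obtain ⟨hal, hl'⟩ := hl
    obtain ⟨hev, hq, hd⟩ := ih hl'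
    simp only [List.foldr_cons]
    refine ⟨fun x => ?_, fun x j hj => ?_, ?_⟩
    · rw [DecisionTree.eval_query]
      constructor
      · intro h i hi
        by_cases hxa : x a = true
        · rw [if_pos hxa] at h
          rcases List.mem_cons.mp hi with rfl | hi
          · exact hxa
          · exact (hev x).mp h i hi
        · rw [if_neg hxa] at h
          simp at h
      · intro h
        rw [if_pos (h a List.mem_cons_self)]
        exact (hev x).mpr fun i hi => h i (List.mem_cons_of_mem a hi)
    · rw [DecisionTree.queries_query, Finset.mem_insert] at hj
      rcases hj with rfl | hj
      · refine ⟨List.mem_cons_self, fun i hi hij => ?_⟩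
        rcases List.mem_cons.mp hi with rfl | hi
        · exact absurd hij (lt_irrefl _)
        · exact absurd hij (lt_asymm (hal i hi))
      · by_cases hxa : x a = true
        · rw [if_pos hxa] at hj
          obtain ⟨hjl, hlt⟩ := hq x j hj
          refine ⟨List.mem_cons_of_mem a hjl, fun i hi hij => ?_⟩
          rcases List.mem_cons.mp hi with rfl | hi
          · exact hxa
          · exact hlt i hi hij
        · rw [if_neg hxa] at hj
          simp at hj
    · rw [DecisionTree.depth_query, hd, DecisionTree.depth_leaf, List.length_cons]
      simp

/-- **The caterpillar tree `t_N`.** There is a decision tree of depth `N` on `N` bits computing `AND_N`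
(accept iff every bit is `1`) whose query set on `x` is contained in `{j : x₀ = … = x_{j-1} = 1}` (it reads
`x₀, x₁, …` and stops at the first `0`). [folklore] -/
theorem exists_caterpillar (N : ℕ) : ∃ t : DecisionTree N, t.depth = N ∧
    (∀ x, t.eval x = true ↔ ∀ i, x i = true) ∧ (∀ x j, j ∈ t.queries x → ∀ i, i < j → x i = true) := by
  obtain ⟨hev, hq, hd⟩ := pathTree_list (List.finRange N) (List.pairwise_lt_finRange N)
  refine ⟨_, by rw [hd, List.length_finRange], fun x => ?_, fun x j hj i hij => ?_⟩
  · rw [hev x]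
    exact ⟨fun h i => h i (List.mem_finRange i), fun h i _ => h i⟩
  · exact (hq x j hj).2 i (List.mem_finRange i) hij

/-! ### The caterpillar's side of the ledger: `Σ F = 1`, `Σ F·g = N·Σ F`, `#{x : j ∈ queries x} ≤ 2^{N-j}` -/

/-- `Σₓ [x ≡ 1] = 1`. [folklore] -/
theorem sum_ite_forall_eq_one :
    ∑ x : Fin N → Bool, (if ∀ i, x i = true then (1 : ℝ) else 0) = 1 := by
  have h := sum_ite_forall_mem (Finset.univ : Finset (Fin N))
  simp only [Finset.mem_univ, forall_true_left, Finset.card_univ, Fintype.card_fin, Nat.sub_self, pow_zero] at h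
  exact h

/-- The query weights of the caterpillar: `#{x : j ∈ t.queries x} ≤ 2^{N − j}`. [folklore] -/
theorem card_queries_caterpillar_le (t : DecisionTree N)
    (hq : ∀ x j, j ∈ t.queries x → ∀ i, i < j → x i = true) (j : Fin N) :
    ((Finset.univ.filter fun x : Fin N → Bool => j ∈ t.queries x).card : ℝ) ≤ (2 : ℝ) ^ (N - (j : ℕ)) := by
  classical
  have hsub : (Finset.univ.filter fun x : Fin N → Bool => j ∈ t.queries x) ⊆
      Finset.univ.filter fun x : Fin N → Bool => ∀ i ∈ Finset.Iio j, x i = true := by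
    intro x hx
    rw [Finset.mem_filter] at hx ⊢
    exact ⟨Finset.mem_univ _, fun i hi => hq x j hx.2 i (Finset.mem_Iio.mp hi)⟩
  calc ((Finset.univ.filter fun x : Fin N → Bool => j ∈ t.queries x).card : ℝ)
      ≤ ((Finset.univ.filter fun x : Fin N → Bool => ∀ i ∈ Finset.Iio j, x i = true).card : ℝ) := by
        exact_mod_cast Finset.card_le_card hsub
    _ = ∑ x : Fin N → Bool, (if ∀ i ∈ Finset.Iio j, x i = true then (1 : ℝ) else 0) := by
        rw [Finset.card_filter]; push_cast; rfl
    _ = (2 : ℝ) ^ (N - (j : ℕ)) := by rw [sum_ite_forall_mem, Fin.card_Iio]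

/-! ### The terminal-run length `g(x) = #{m : x_m = … = x_{N-1} = 1}` and its squared increments -/

/-- The increment of the terminal-run length across coordinate `j`:
`g(x^{j→1}) − g(x^{j→0}) = Σ_{m ≤ j} [∀ i ≥ m, i ≠ j → x i = 1]`. [folklore] -/
theorem increment_runLength (g : (Fin N → Bool) → ℝ)
    (hg : ∀ x, g x = ∑ m : Fin N, (if ∀ i, m ≤ i → x i = true then (1 : ℝ) else 0)) (x : Fin N → Bool) (j : Fin N) :
    g (update x j true) - g (update x j false) =
      ∑ m : Fin N, (if m ≤ j ∧ ∀ i, m ≤ i → i ≠ j → x i = true then (1 : ℝ) else 0) := by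
  rw [hg, hg, ← Finset.sum_sub_distrib]
  refine Finset.sum_congr rfl fun m _ => ?_
  by_cases hmj : m ≤ j
  · -- `m ≤ j`: with `x j := 0` the run condition fails, with `x j := 1` it is the punctured condition
    have h0 : ¬ ∀ i, m ≤ i → (update x j false) i = true := fun h => by
      have := h j hmj
      simp at this
    by_cases hp : ∀ i, m ≤ i → i ≠ j → x i = true
    · have h1 : ∀ i, m ≤ i → (update x j true) i = true := by
        intro i hi
        by_cases hij : i = j
        · subst hij; simp
        · rw [update_of_ne hij]; exact hp i hi hij
      rw [if_pos h1, if_neg h0, if_pos ⟨hmj, hp⟩]; ring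
    · have h1 : ¬ ∀ i, m ≤ i → (update x j true) i = true := fun h => hp fun i hi hij => by
        have := h i hi; rwa [update_of_ne hij] at this
      rw [if_neg h1, if_neg h0, if_neg (fun h => hp h.2)]; ring
  · -- `j < m`: coordinate `j` is not in the run window
    have hsame : ∀ c, (∀ i, m ≤ i → (update x j c) i = true) ↔ ∀ i, m ≤ i → x i = true := by
      intro c
      refine forall₂_congr fun i hi => ?_
      rw [update_of_ne]
      rintro rfl
      exact hmj hi
    simp only [hsame, hmj, false_and, if_false, sub_self]

/-- Products of the punctured run indicators are nested: for `m, m' ≤ j`,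
`[run' ≥ m]·[run' ≥ m'] = [run' ≥ min m m']`, and the product vanishes unless `m, m' ≤ j`. [folklore] -/
theorem runInd_mul_runInd (x : Fin N → Bool) (j m m' : Fin N) :
    (if m ≤ j ∧ ∀ i, m ≤ i → i ≠ j → x i = true then (1 : ℝ) else 0) *
      (if m' ≤ j ∧ ∀ i, m' ≤ i → i ≠ j → x i = true then (1 : ℝ) else 0) =
      if (m ≤ j ∧ m' ≤ j) ∧ ∀ i, min m m' ≤ i → i ≠ j → x i = true then (1 : ℝ) else 0 := by
  wlog hmm : m ≤ m' generalizing m m'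
  · rw [mul_comm, min_comm, this m' m (le_of_not_ge hmm)]
    simp only [and_comm]
  rw [min_eq_left hmm]
  by_cases hm : m ≤ j ∧ ∀ i, m ≤ i → i ≠ j → x i = true
  · by_cases hm'j : m' ≤ j
    · have hm' : m' ≤ j ∧ ∀ i, m' ≤ i → i ≠ j → x i = true :=
        ⟨hm'j, fun i hi hij => hm.2 i (hmm.trans hi) hij⟩
      rw [if_pos hm, if_pos hm', if_pos ⟨⟨hm.1, hm'j⟩, hm.2⟩, one_mul]
    · rw [if_pos hm, if_neg (fun h => hm'j h.1), if_neg (fun h => hm'j h.1.2), one_mul]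
  · rw [if_neg hm, zero_mul, if_neg]
    exact fun h => hm ⟨h.1.1, h.2⟩

/-- The cube sum of a product of two punctured run indicators: `2^{min(m,m')+1}` if `m, m' ≤ j`, else `0`.
[folklore] -/
theorem sum_runInd_mul_runInd (j m m' : Fin N) :
    ∑ x : Fin N → Bool, (if m ≤ j ∧ ∀ i, m ≤ i → i ≠ j → x i = true then (1 : ℝ) else 0) *
        (if m' ≤ j ∧ ∀ i, m' ≤ i → i ≠ j → x i = true then (1 : ℝ) else 0) =
      if m ≤ j ∧ m' ≤ j then (2 : ℝ) ^ ((min m m' : ℕ) + 1) else 0 := by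
  classical
  simp_rw [runInd_mul_runInd]
  by_cases hmm : m ≤ j ∧ m' ≤ j
  · rw [if_pos hmm]
    have hμ : min m m' ≤ j := (min_le_left m m').trans hmm.1
    -- the constraint set `{i : min ≤ i, i ≠ j} = (Ici min).erase j`
    have hset : ∀ x : Fin N → Bool, (∀ i, min m m' ≤ i → i ≠ j → x i = true) ↔
        ∀ i ∈ (Finset.Ici (min m m')).erase j, x i = true := by
      intro x
      constructor
      · intro h i hi
        rw [Finset.mem_erase, Finset.mem_Ici] at hi
        exact h i hi.2 hi.1
      · intro h i hi hij
        exact h i (Finset.mem_erase.mpr ⟨hij, Finset.mem_Ici.mpr hi⟩)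
    have hre : ∀ x : Fin N → Bool,
        (if (m ≤ j ∧ m' ≤ j) ∧ ∀ i, min m m' ≤ i → i ≠ j → x i = true then (1 : ℝ) else 0) =
        if ∀ i ∈ (Finset.Ici (min m m')).erase j, x i = true then (1 : ℝ) else 0 := by
      intro x
      simp only [hmm, true_and, hset x]
    rw [Finset.sum_congr rfl fun x _ => hre x, sum_ite_forall_mem]
    congr 1
    have hcard : ((Finset.Ici (min m m')).erase j).card = (N - (min m m' : ℕ)) - 1 := by
      rw [Finset.card_erase_of_mem (Finset.mem_Ici.mpr hμ), Fin.card_Ici, Fin.coe_min]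
    rw [hcard]
    have h1 : (m : ℕ) < N := m.isLt
    have h2 : (m' : ℕ) < N := m'.isLt
    rcases le_total (m : ℕ) (m' : ℕ) with h | h
    · rw [min_eq_left h]; omega
    · rw [min_eq_right h]; omega
  · rw [if_neg hmm]
    refine Finset.sum_eq_zero fun x _ => ?_
    rw [if_neg]
    exact fun h => hmm h.1

/-- Passing from `Fin N`-indexed sums supported on `{m ≤ j}` to `range (j+1)`-indexed sums. [folklore] -/
theorem sum_fin_ite_le_eq_sum_range (j : Fin N) (f : ℕ → ℝ) :
    ∑ m : Fin N, (if m ≤ j then f m else 0) = ∑ m ∈ Finset.range ((j : ℕ) + 1), f m := by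
  have h1 : ∑ m : Fin N, (if m ≤ j then f m else 0) =
      ∑ m ∈ Finset.range N, (if m ≤ (j : ℕ) then f m else 0) := by
    rw [← Fin.sum_univ_eq_sum_range (fun m => if m ≤ (j : ℕ) then f m else 0)]
    refine Finset.sum_congr rfl fun m _ => ?_
    simp only [Fin.le_iff_val_le_val]
  rw [h1, ← Finset.sum_filter]
  congr 1
  ext m
  simp only [Finset.mem_filter, Finset.mem_range]
  have := j.isLt
  omega

/-- The double geometric sum: `Σ_{m,m' ≤ j} 2^{min(m,m')} + 2j + 5 ≤ 6·2^j` (in fact equality). [folklore] -/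
theorem sum_sum_pow_min_le (j : ℕ) :
    ∑ m ∈ Finset.range (j + 1), ∑ m' ∈ Finset.range (j + 1), (2 : ℝ) ^ (min m m') + 2 * j + 5 ≤ 6 * 2 ^ j := by
  induction j with
  | zero => norm_num
  | succ j ih =>
    -- peel off `m = j+1` and `m' = j+1`
    have hrow : ∀ m ∈ Finset.range (j + 1), ∑ m' ∈ Finset.range (j + 2), (2 : ℝ) ^ (min m m') =
        ∑ m' ∈ Finset.range (j + 1), (2 : ℝ) ^ (min m m') + 2 ^ m := by
      intro m hm
      rw [Finset.sum_range_succ, min_eq_left (by rw [Finset.mem_range] at hm; omega)]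
    have hlast : ∑ m' ∈ Finset.range (j + 2), (2 : ℝ) ^ (min (j + 1) m') =
        ∑ m' ∈ Finset.range (j + 1), (2 : ℝ) ^ m' + 2 ^ (j + 1) := by
      rw [Finset.sum_range_succ, min_self]
      congr 1
      refine Finset.sum_congr rfl fun m' hm' => ?_
      rw [min_eq_right (by rw [Finset.mem_range] at hm'; omega)]
    have hgeom : ∑ m ∈ Finset.range (j + 1), (2 : ℝ) ^ m = 2 ^ (j + 1) - 1 := by
      rw [geom_sum_eq (by norm_num : (2 : ℝ) ≠ 1)]
      ring
    rw [Finset.sum_range_succ, Finset.sum_congr rfl hrow, Finset.sum_add_distrib, hlast, hgeom]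
    push_cast
    have h2 : (2 : ℝ) ^ (j + 1) = 2 * 2 ^ j := by ring
    rw [h2]
    nlinarith [ih, pow_pos (by norm_num : (0 : ℝ) < 2) j]

/-- **Squared increments of the terminal-run length.** For `g(x) = #{m : x_m = … = x_{N-1} = 1}` and every `j`:
`Σₓ (g(x^{j→1}) − g(x^{j→0}))² ≤ 12·2^j` (exactly `2·(6·2^j − 2j − 5)`). [folklore] -/
theorem sum_sq_increment_runLength_le (g : (Fin N → Bool) → ℝ)
    (hg : ∀ x, g x = ∑ m : Fin N, (if ∀ i, m ≤ i → x i = true then (1 : ℝ) else 0)) (j : Fin N) :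
    ∑ x, (g (update x j true) - g (update x j false)) ^ 2 ≤ 12 * (2 : ℝ) ^ (j : ℕ) := by
  classical
  have hsq : ∀ x : Fin N → Bool, (g (update x j true) - g (update x j false)) ^ 2 =
      ∑ m : Fin N, ∑ m' : Fin N,
        (if m ≤ j ∧ ∀ i, m ≤ i → i ≠ j → x i = true then (1 : ℝ) else 0) *
          (if m' ≤ j ∧ ∀ i, m' ≤ i → i ≠ j → x i = true then (1 : ℝ) else 0) := by
    intro x
    rw [increment_runLength g hg x j, sq, Finset.sum_mul_sum]
  rw [Finset.sum_congr rfl fun x _ => hsq x, Finset.sum_comm]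
  simp_rw [Finset.sum_comm (s := (Finset.univ : Finset (Fin N → Bool)))]
  simp_rw [sum_runInd_mul_runInd]
  -- now `Σ_m Σ_m' [m ≤ j ∧ m' ≤ j] 2^{min+1}`
  have hinner : ∀ m : Fin N, ∑ m' : Fin N, (if m ≤ j ∧ m' ≤ j then (2 : ℝ) ^ ((min m m' : ℕ) + 1) else 0) =
      if m ≤ j then ∑ m' ∈ Finset.range ((j : ℕ) + 1), (2 : ℝ) ^ (min (m : ℕ) m' + 1) else 0 := by
    intro m
    by_cases hm : m ≤ j
    · rw [if_pos hm, ← sum_fin_ite_le_eq_sum_range j (fun m' => (2 : ℝ) ^ (min (m : ℕ) m' + 1))]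
      refine Finset.sum_congr rfl fun m' _ => ?_
      simp only [hm, true_and]
    · rw [if_neg hm]
      refine Finset.sum_eq_zero fun m' _ => ?_
      rw [if_neg (fun h => hm h.1)]
  rw [Finset.sum_congr rfl fun m _ => hinner m,
    sum_fin_ite_le_eq_sum_range j (fun m => ∑ m' ∈ Finset.range ((j : ℕ) + 1), (2 : ℝ) ^ (min m m' + 1))]
  have hfac : ∑ m ∈ Finset.range ((j : ℕ) + 1), ∑ m' ∈ Finset.range ((j : ℕ) + 1), (2 : ℝ) ^ (min m m' + 1) =
      2 * ∑ m ∈ Finset.range ((j : ℕ) + 1), ∑ m' ∈ Finset.range ((j : ℕ) + 1), (2 : ℝ) ^ (min m m') := by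
    rw [Finset.mul_sum]
    refine Finset.sum_congr rfl fun m _ => ?_
    rw [Finset.mul_sum]
    refine Finset.sum_congr rfl fun m' _ => ?_
    ring
  rw [hfac]
  have := sum_sum_pow_min_le (j : ℕ)
  have hj0 : (0 : ℝ) ≤ (j : ℕ) := Nat.cast_nonneg _
  linarith

end ClassicalCornerL2OSSSNoGo

end Summit.QuantumAdvantage.QuantumAdvantage.Theorems.SosSandwich

end
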